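import Mathlib
import HarnessLib
import Summits.HubbardSuperconductivity.HubbardSuperconductivity.Theorems.KLProgrammeC4aPathJets
import Summits.HubbardSuperconductivity.HubbardSuperconductivity.Theorems.KLProgrammeC4aLevelDensityRadialVertex

/-!
# Route `KLProgramme` — crux C4a, (L3) LOWER COMPARABILITY of the pair-sum path: `‖Φ(0,θ) + Φ(ρ,ϑ+θ)‖ ≥ c·(|ρ| + |ϑ − π|)` on the whole chart
# box, uniformly in `θ`, with an explicit window-uniform constant `c = pairSumLowerConst r`

Cell `gate-hubbard-kl`, lane hubbard-kl-c4a-1 (g5); helper for stub (C) `stub_twoLeg_curvature` of the engine-flow child `KLRegimeEngineV17F2`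
(stmt-HubbardSuperconductivity-20437); memo HOME/hubbard-kl-c4a-1/C4A-PLAN.md §22.5.  WHY: `…C4aPathRigidity` bounds the pair-sum path's jets ABOVE by the
chart distance to the Cooper point, `‖∂ⁱS(0)‖ ≲ |ρ| + |ϑ − π|`; the scale-resolved pp bubble's Fréchet jets are `≍ max(‖S(0)‖, Λ_n)^{−k}`; the Bell monomials
`Mb_k·Π Ds` are `O(1)` — hence the `ϑ`-integral `n`-free — exactly when `‖S(0)‖` is bounded BELOW by the same chart distance.  This file proves that
TRANSVERSALITY of the co-moving chart at the Cooper configuration, from three elementary facts: (⊥) the component of `S(0) = u_ρ(φ)·dir φ + u₀(θ)·dir θ`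
(`φ = ϑ + θ`) orthogonal to `dir φ` is `u₀(θ)·sin ϑ` (`|·| ≥ (2u_min/π)|ϑ − π|` near `π`); (∥) its component along `dir φ` is `u_ρ(φ) + u₀(θ)cos ϑ`, and the
radius is INCREASING in the level with slope `≥ 1/(4 + 2A) ≥ 10/41` (`∂_μ u = 1/(∂_tε₀ + Dδ_K[dir])`, `|∂_tε₀| ≤ 4`, `‖Dδ_K‖ ≤ 2A`, `A ≤ 1/20`) and
`klCurveR1`-Lipschitz in the angle; (far) for `cos ϑ ≥ 0` the ∥-component alone is `≥ u_min`.

* §1 `abs_proj_le_norm` (a planar projection is bounded by the Euclidean norm), `pairSumPath_zero_proj_perp/_par` (the two components in closed form);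
* §2 **`frameRadius_level_sub_ge`** — radial monotonicity with slope: `(10/41)·(ν₂ − ν₁) ≤ u_K(ν₂;s) − u_K(ν₁;s)` for tube levels `ν₁ ≤ ν₂`;
  `abs_frameRadius_sub_le_angle` (`|u_K(ν;s) − u_K(ν;s′)| ≤ klCurveR1·|s − s′|`);
* §3 `pairSumLowerConst r` (def: `min (u_min/(r+π)) (min (u_min/π) (min (10/164) (10u_min/(82π(klCurveR1 + π²√2/4)))))`, positive),
  **`norm_pairSumPath_zero_ge`**: for `|ρ| < r`, `ϑ ∈ [0, 2π]`, every `θ`: `pairSumLowerConst r·(|ρ| + |ϑ − π|) ≤ ‖S_{ρ,ϑ,θ}(0)‖`.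

Proved calculus on the tree's objects, keyed by the frame's sizes exactly as `…C4aPathJets` (`A ≤ 1/20`, `klCurveD ≤ Dt_min − 2A`, tube margins
`−1.1 < μ − r − A`, `μ + r + A < −0.1`, `A₃`, `A₄`); nothing about the Hubbard model's sizes; nothing asserts superconductivity.
References: FST II CPAM 51 (1998) §3 Thm 3.5; BGM 2006 §2.4 Lemma 2.1 (2.40)–(2.41) [cite: BenfattoGiulianiMastropietro2006].
-/

noncomputable section

namespace Summit.HubbardSuperconductivity.HubbardSuperconductivity.Theorems.C4a

set_option linter.dupNamespace false -- summit = problem name (single-conjunct summit), D-0017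

open Real Set MeasureTheory Finset
open scoped ContDiff
open Literature.MathematicalPhysics.QuantumLattice Literature.MathematicalPhysics.QuantumLattice.BandSectorCounting Literature.Probability.LatticeModels
open Summit.HubbardSuperconductivity.HubbardSuperconductivity.Theorems.KLRegimeSplit
open Summit.HubbardSuperconductivity.HubbardSuperconductivity.Theorems.DispersionFlow
open Summit.HubbardSuperconductivity.HubbardSuperconductivity.Theorems.PerturbedFermiCurve

/-! ## §1 Planar projections of the pair sum -/

/-- A planar projection is bounded by the Euclidean norm: `|v₀ cos ψ + v₁ sin ψ| ≤ ‖v‖`. -/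
theorem abs_proj_le_norm (v : Momentum) (ψ : ℝ) : |v.ofLp 0 * Real.cos ψ + v.ofLp 1 * Real.sin ψ| ≤ ‖v‖ := by
  rw [EuclideanSpace.norm_eq, Fin.sum_univ_two, Real.norm_eq_abs, Real.norm_eq_abs, sq_abs, sq_abs]
  refine Real.abs_le_sqrt ?_
  have h : (v.ofLp 0 * Real.cos ψ + v.ofLp 1 * Real.sin ψ) ^ 2 =
      v.ofLp 0 ^ 2 + v.ofLp 1 ^ 2 - (v.ofLp 0 * Real.sin ψ - v.ofLp 1 * Real.cos ψ) ^ 2 := by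
    linear_combination (v.ofLp 0 ^ 2 + v.ofLp 1 ^ 2) * Real.sin_sq_add_cos_sq ψ
  rw [h]
  linarith [sq_nonneg (v.ofLp 0 * Real.sin ψ - v.ofLp 1 * Real.cos ψ)]

/-- **The component of `S_{ρ,ϑ,θ}(0)` orthogonal to the loop ray `dir(ϑ+θ)`**: `−S₀ sin φ + S₁ cos φ = −u_K(μ;θ)·sin ϑ` (`φ = ϑ + θ`). -/
theorem pairSumPath_zero_proj_perp (μ : ℝ) (K : TrigPolyC4v) (ρ ϑ θ : ℝ) :
    (pairSumPath μ K ρ ϑ θ 0).ofLp 0 * Real.cos (ϑ + θ + π / 2) + (pairSumPath μ K ρ ϑ θ 0).ofLp 1 * Real.sin (ϑ + θ + π / 2) =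
      -(perturbedFermiRadius (fun k : Fin 2 → ℝ => -K.eval k) (μ + 0) θ * Real.sin ϑ) := by
  rw [pairSumPath_apply_zero, WithLp.ofLp_add, Pi.add_apply, Pi.add_apply, levelPoint_apply_zero, levelPoint_apply_zero,
    levelPoint_apply_one, levelPoint_apply_one, Real.cos_add_pi_div_two, Real.sin_add_pi_div_two]
  have hs : Real.sin ϑ = Real.sin (ϑ + θ) * Real.cos θ - Real.cos (ϑ + θ) * Real.sin θ := by
    rw [show ϑ = (ϑ + θ) - θ by ring, Real.sin_sub]; ring_nf
  rw [hs]; ring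

/-- **The component of `S_{ρ,ϑ,θ}(0)` along the loop ray `dir(ϑ+θ)`**: `S₀ cos φ + S₁ sin φ = u_K(μ+ρ;φ) + u_K(μ;θ)·cos ϑ` (`φ = ϑ + θ`). -/
theorem pairSumPath_zero_proj_par (μ : ℝ) (K : TrigPolyC4v) (ρ ϑ θ : ℝ) :
    (pairSumPath μ K ρ ϑ θ 0).ofLp 0 * Real.cos (ϑ + θ) + (pairSumPath μ K ρ ϑ θ 0).ofLp 1 * Real.sin (ϑ + θ) =
      perturbedFermiRadius (fun k : Fin 2 → ℝ => -K.eval k) (μ + ρ) (ϑ + θ) +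
        perturbedFermiRadius (fun k : Fin 2 → ℝ => -K.eval k) (μ + 0) θ * Real.cos ϑ := by
  rw [pairSumPath_apply_zero, WithLp.ofLp_add, Pi.add_apply, Pi.add_apply, levelPoint_apply_zero, levelPoint_apply_zero,
    levelPoint_apply_one, levelPoint_apply_one]
  have hc : Real.cos ϑ = Real.cos θ * Real.cos (ϑ + θ) + Real.sin θ * Real.sin (ϑ + θ) := by
    rw [show ϑ = (ϑ + θ) - θ by ring, Real.cos_sub]; ring_nf
  rw [hc]
  linear_combination perturbedFermiRadius (fun k : Fin 2 → ℝ => -K.eval k) (μ + ρ) (ϑ + θ) * Real.sin_sq_add_cos_sq (ϑ + θ)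

/-! ## §2 Radial monotonicity with slope, angular Lipschitz of the radius -/

section Sizes

variable {K : TrigPolyC4v} {A : ℝ} (hA : ∀ p : Momentum, ∀ j ≤ 2, ‖iteratedFDeriv ℝ j (frameShift K) p‖ ≤ A) (hA20 : A ≤ 1 / 20)
  (hd : klCurveD ≤ (bandBounds (show (-4 : ℝ) < -1.1 by norm_num) (show (-1.1 : ℝ) ≤ -0.1 by norm_num)
    (show (-0.1 : ℝ) < 0 by norm_num)).Dtmin - 2 * A)
  {μ r : ℝ} (hr : 0 < r) (hlo : (-1.1 : ℝ) < μ - r - A) (hhi : μ + r + A < -0.1)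
  {A₃ A₄ : ℝ} (hA₃ : ∀ p : Momentum, ‖iteratedFDeriv ℝ 3 (frameShift K) p‖ ≤ A₃)
  (hA₄ : ∀ p : Momentum, ‖iteratedFDeriv ℝ 4 (frameShift K) p‖ ≤ A₄)
include hA hA20 hd hr hlo hhi hA₃ hA₄

omit hr hlo hhi hA₃ hA₄ in
/-- **Radial monotonicity with slope**: for tube levels `ν₁ ≤ ν₂` (`−1.1 < ν₁ − A`, `ν₂ + A < −0.1`) and every angle `s`,
`(10/41)·(ν₂ − ν₁) ≤ u_K(ν₂;s) − u_K(ν₁;s)` (`∂_μ u = 1/(∂_tε₀ + Dδ_K[dir]) ≥ 1/(4 + 2A) ≥ 10/41`). [cite: BenfattoGiulianiMastropietro2006, §2.4 (2.41)] -/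
theorem frameRadius_level_sub_ge {ν₁ ν₂ : ℝ} (h12 : ν₁ ≤ ν₂) (hlo1 : (-1.1 : ℝ) < ν₁ - A) (hhi2 : ν₂ + A < -0.1) (s : ℝ) :
    10 / 41 * (ν₂ - ν₁) ≤
      perturbedFermiRadius (fun k : Fin 2 → ℝ => -K.eval k) ν₂ s - perturbedFermiRadius (fun k : Fin 2 → ℝ => -K.eval k) ν₁ s := by
  set B := bandBounds (show (-4 : ℝ) < -1.1 by norm_num) (show (-1.1 : ℝ) ≤ -0.1 by norm_num) (show (-0.1 : ℝ) < 0 by norm_num) with hBdef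
  have hADt : 2 * A < B.Dtmin := by have := klCurveD_pos; linarith
  have hC : ContDiff ℝ 1 (fun k : Fin 2 → ℝ => -K.eval k) := by
    rw [← frameShift_toLp_eq_neg_eval]; exact contDiff_frameShift_toLp K
  have hδ : ∀ k : Fin 2 → ℝ, (∀ i, |k i| ≤ π) → |(fun q : Fin 2 → ℝ => -K.eval q) k| ≤ A := fun k _ => by
    simpa [frameShift_toLp] using abs_frameShift_toLp_le hA k
  have hκ : ∀ k : Fin 2 → ℝ, (∀ i, |k i| ≤ π) → ‖fderiv ℝ (fun q : Fin 2 → ℝ => -K.eval q) k‖ ≤ 2 * A := fun k _ => by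
    rw [← frameShift_toLp_eq_neg_eval]; exact norm_fderiv_frameShift_toLp_le hA k
  have hκall : ∀ k : Fin 2 → ℝ, ‖fderiv ℝ (fun q : Fin 2 → ℝ => -K.eval q) k‖ ≤ 2 * A := fun k => by
    rw [← frameShift_toLp_eq_neg_eval]; exact norm_fderiv_frameShift_toLp_le hA k
  set f : ℝ → ℝ := fun m => perturbedFermiRadius (fun k : Fin 2 → ℝ => -K.eval k) m s with hfdef
  -- at every tube level: derivative `D⁻¹` with `0 < D ≤ 4 + 2A`
  have hder : ∀ m ∈ Icc ν₁ ν₂, ∃ D : ℝ, HasDerivAt f D⁻¹ m ∧ 0 < D ∧ D ≤ 4 + 2 * A := by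
    intro m hm
    have h1 : (-1.1 : ℝ) < m - A := by have := hm.1; linarith
    have h2 : m + A < -0.1 := by have := hm.2; linarith
    have hHD := hasDerivAt_perturbedFermiRadius_level B hC one_ne_zero hδ hκ hADt h1 h2 s
    have hpos := (deriv_perturbedFermiRadius_level_pos_le B hC one_ne_zero hδ hκ hADt h1 h2 s).1
    rw [hHD.deriv] at hpos
    refine ⟨_, hHD, inv_pos.1 hpos, ?_⟩
    refine (add_le_add (le_of_abs_le (abs_rayDispersionDt_le_four _ _)) ((le_abs_self _).trans ?_))
    rw [← Real.norm_eq_abs]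
    refine (ContinuousLinearMap.le_opNorm _ _).trans ?_
    have hA0 : 0 ≤ 2 * A := by have := (norm_nonneg _).trans (hA 0 0 (by norm_num)); linarith
    calc _ ≤ 2 * A * 1 := mul_le_mul (hκall _) (norm_dir_le_one _) (norm_nonneg _) hA0
      _ = 2 * A := mul_one _
  have hcont : ContinuousOn f (Icc ν₁ ν₂) := fun m hm => by
    obtain ⟨D, hD, -, -⟩ := hder m hm
    exact hD.continuousAt.continuousWithinAt
  have hdiff : DifferentiableOn ℝ f (interior (Icc ν₁ ν₂)) := fun m hm => by
    obtain ⟨D, hD, -, -⟩ := hder m (interior_subset hm)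
    exact hD.differentiableAt.differentiableWithinAt
  have hge : ∀ m ∈ interior (Icc ν₁ ν₂), (10 / 41 : ℝ) ≤ deriv f m := fun m hm => by
    obtain ⟨D, hD, hD0, hD4⟩ := hder m (interior_subset hm)
    rw [hD.deriv]
    have h41 : D ≤ 41 / 10 := by linarith
    calc (10 / 41 : ℝ) = (41 / 10)⁻¹ := by norm_num
      _ ≤ D⁻¹ := inv_anti₀ hD0 h41
  exact (convex_Icc ν₁ ν₂).mul_sub_le_image_sub_of_le_deriv hcont hdiff hge ν₁ (left_mem_Icc.2 h12) ν₂ (right_mem_Icc.2 h12) h12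

omit hr hlo hhi in
/-- **Angular Lipschitz of the radius at a tube level** (`−1.1 ≤ ν − A`, `ν + A ≤ −0.1`): `|u_K(ν;s) − u_K(ν;s′)| ≤ klCurveR1·|s − s′|`. -/
theorem abs_frameRadius_sub_le_angle {ν : ℝ} (hlo' : (-1.1 : ℝ) ≤ ν - A) (hhi' : ν + A ≤ -0.1) (s s' : ℝ) :
    |perturbedFermiRadius (fun k : Fin 2 → ℝ => -K.eval k) ν s - perturbedFermiRadius (fun k : Fin 2 → ℝ => -K.eval k) ν s'| ≤
      klCurveR1 * |s - s'| := by
  set B := bandBounds (show (-4 : ℝ) < -1.1 by norm_num) (show (-1.1 : ℝ) ≤ -0.1 by norm_num) (show (-0.1 : ℝ) < 0 by norm_num) with hBdef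
  have hADt : 2 * A < B.Dtmin := by have := klCurveD_pos; linarith
  have hCd : ContDiff ℝ ((1 : ℕ∞) : WithTop ℕ∞) (perturbedFermiRadius (fun p : Fin 2 → ℝ => -K.eval p) ν) :=
    contDiff_klFermiRadius B hA hADt hlo' hhi' (m := 1)
  have hdiff : Differentiable ℝ (perturbedFermiRadius (fun p : Fin 2 → ℝ => -K.eval p) ν) := hCd.differentiable (by norm_num)
  have hbound : ∀ x ∈ (univ : Set ℝ), ‖deriv (perturbedFermiRadius (fun p : Fin 2 → ℝ => -K.eval p) ν) x‖ ≤ klCurveR1 := fun x _ => by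
    rw [Real.norm_eq_abs]; exact (frameRadius_tower_of_sizes hA hA20 hd hlo' hhi' hA₃ hA₄ x).2.1
  have h := (convex_univ (𝕜 := ℝ) (E := ℝ)).norm_image_sub_le_of_norm_deriv_le (fun x _ => hdiff x) hbound (mem_univ s') (mem_univ s)
  rwa [Real.norm_eq_abs, Real.norm_eq_abs] at h

/-! ## §3 Lower comparability -/

omit hA hA20 hd hr hlo hhi hA₃ hA₄ in
/-- **The lower-comparability constant** of the pair-sum path on a tube of radius `r` (window-uniform; `u_min` of the standard band bundle on
`[−1.1, −0.1]`, `klCurveR1` the angular Lipschitz size of the radius):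
`min (u_min/(r+π)) (min (u_min/π) (min (10/164) (10·u_min/(82·π·(klCurveR1 + π²√2/4)))))`. -/
def pairSumLowerConst (r : ℝ) : ℝ :=
  min ((bandBounds (show (-4 : ℝ) < -1.1 by norm_num) (show (-1.1 : ℝ) ≤ -0.1 by norm_num) (show (-0.1 : ℝ) < 0 by norm_num)).umin / (r + π))
    (min ((bandBounds (show (-4 : ℝ) < -1.1 by norm_num) (show (-1.1 : ℝ) ≤ -0.1 by norm_num) (show (-0.1 : ℝ) < 0 by norm_num)).umin / π)
      (min (10 / 164) (10 * (bandBounds (show (-4 : ℝ) < -1.1 by norm_num) (show (-1.1 : ℝ) ≤ -0.1 by norm_num)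
        (show (-0.1 : ℝ) < 0 by norm_num)).umin / (82 * π * (klCurveR1 + π ^ 2 * Real.sqrt 2 / 4)))))

omit hA hA20 hd hlo hhi hA₃ hA₄ in
/-- The lower-comparability constant is positive. -/
theorem pairSumLowerConst_pos : 0 < pairSumLowerConst r := by
  have hu := (bandBounds (show (-4 : ℝ) < -1.1 by norm_num) (show (-1.1 : ℝ) ≤ -0.1 by norm_num) (show (-0.1 : ℝ) < 0 by norm_num)).umin_pos
  have hR := klCurveR1_nonneg
  have hπ := Real.pi_pos
  unfold pairSumLowerConst
  refine lt_min (by positivity) (lt_min (by positivity) (lt_min (by norm_num) ?_))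
  positivity

/-- **LOWER COMPARABILITY of the pair-sum path (transversality of the co-moving chart at the Cooper configuration).**  For `|ρ| < r`, `ϑ ∈ [0, 2π]`
and every base angle `θ`: `pairSumLowerConst r·(|ρ| + |ϑ − π|) ≤ ‖Φ(0,θ) + Φ(ρ,ϑ+θ)‖`.  Together with `…C4aPathRigidity` (`‖∂ⁱS(0)‖ ≲ |ρ| + |ϑ − π|`) this
makes every Bell monomial of the pp class `O(1)` against Fréchet majorants `≍ max(‖S(0)‖, Λ)^{−k}`. [cite: BenfattoGiulianiMastropietro2006, §2.4 (2.40)–(2.41)] -/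
theorem norm_pairSumPath_zero_ge {ρ : ℝ} (hρ : |ρ| < r) {ϑ : ℝ} (hϑ : ϑ ∈ Icc 0 (2 * π)) (θ : ℝ) :
    pairSumLowerConst r * (|ρ| + |ϑ - π|) ≤ ‖pairSumPath μ K ρ ϑ θ 0‖ := by
  set B := bandBounds (show (-4 : ℝ) < -1.1 by norm_num) (show (-1.1 : ℝ) ≤ -0.1 by norm_num) (show (-0.1 : ℝ) < 0 by norm_num) with hBdef
  set S := pairSumPath μ K ρ ϑ θ 0 with hSdef
  set u₀ := perturbedFermiRadius (fun k : Fin 2 → ℝ => -K.eval k) (μ + 0) θ with hu₀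
  set uρ := perturbedFermiRadius (fun k : Fin 2 → ℝ => -K.eval k) (μ + ρ) (ϑ + θ) with huρ
  set u₀φ := perturbedFermiRadius (fun k : Fin 2 → ℝ => -K.eval k) (μ + 0) (ϑ + θ) with hu₀φ
  set c := pairSumLowerConst r with hcdef
  set d := |ϑ - π| with hddef
  set C₁ := klCurveR1 + π ^ 2 * Real.sqrt 2 / 4 with hC₁def
  have hπ := Real.pi_pos
  have hρ1 := (abs_lt.1 hρ).1
  have hρ2 := (abs_lt.1 hρ).2
  have humin : 0 < B.umin := B.umin_pos
  have hR1 : 0 ≤ klCurveR1 := klCurveR1_nonneg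
  have hC₁ : 0 < C₁ := by positivity
  -- radii: sizes
  have hm0lo : (-1.1 : ℝ) ≤ μ + 0 - A := by linarith
  have hm0hi : μ + 0 + A ≤ -0.1 := by linarith
  have hmρlo : (-1.1 : ℝ) ≤ μ + ρ - A := by linarith
  have hmρhi : μ + ρ + A ≤ -0.1 := by linarith
  have hm0hi' : μ + 0 + A < -0.1 := by linarith
  have hmρhi' : μ + ρ + A < -0.1 := by linarith
  have hu₀min : B.umin ≤ u₀ := umin_le_frameRadius B hA hm0lo hm0hi θ
  have huρmin : B.umin ≤ uρ := umin_le_frameRadius B hA hmρlo hmρhi (ϑ + θ)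
  have hu₀le : u₀ ≤ π * Real.sqrt 2 := frameRadius_le B hA hm0lo hm0hi θ
  have hu₀pos : 0 < u₀ := humin.trans_le hu₀min
  -- the two projections
  have hperp : u₀ * |Real.sin ϑ| ≤ ‖S‖ := by
    have h := abs_proj_le_norm S (ϑ + θ + π / 2)
    rwa [hSdef, pairSumPath_zero_proj_perp, abs_neg, abs_mul, abs_of_pos hu₀pos] at h
  have hpar : |uρ + u₀ * Real.cos ϑ| ≤ ‖S‖ := by
    have h := abs_proj_le_norm S (ϑ + θ)
    rwa [hSdef, pairSumPath_zero_proj_par] at h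
  -- bookkeeping on d and c
  have hdle : d ≤ π := by rw [hddef]; exact abs_sub_le_iff.2 ⟨by linarith [hϑ.2], by linarith [hϑ.1]⟩
  have hd0 : 0 ≤ d := abs_nonneg _
  have hc1 : c ≤ B.umin / (r + π) := min_le_left _ _
  have hc2 : c ≤ B.umin / π := (min_le_right _ _).trans (min_le_left _ _)
  have hc3 : c ≤ 10 / 164 := ((min_le_right _ _).trans (min_le_right _ _)).trans (min_le_left _ _)
  have hc4 : c ≤ 10 * B.umin / (82 * π * C₁) := ((min_le_right _ _).trans (min_le_right _ _)).trans (min_le_right _ _)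
  have hc0 : 0 < c := pairSumLowerConst_pos hr
  rcases le_or_gt (π / 2) d with hfar | hfar
  · -- far from the Cooper point: `cos ϑ ≥ 0`, the ∥-component alone is `≥ u_min`
    have hcos : 0 ≤ Real.cos ϑ := by
      rcases le_or_gt ϑ π with h | h
      · have : π - ϑ = d := by rw [hddef, abs_sub_comm, abs_of_nonneg (by linarith)]
        exact Real.cos_nonneg_of_mem_Icc ⟨by linarith [hϑ.1], by linarith⟩
      · have : ϑ - π = d := by rw [hddef, abs_of_nonneg (by linarith)]
        rw [← Real.cos_sub_two_pi]
        exact Real.cos_nonneg_of_mem_Icc ⟨by linarith, by linarith [hϑ.2]⟩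
    have h1 : B.umin ≤ ‖S‖ := by
      refine le_trans ?_ hpar
      have h0 : 0 ≤ u₀ * Real.cos ϑ := mul_nonneg hu₀pos.le hcos
      calc B.umin ≤ uρ + u₀ * Real.cos ϑ := by linarith
        _ ≤ |uρ + u₀ * Real.cos ϑ| := le_abs_self _
    have h2 : |ρ| + d ≤ r + π := by linarith [hρ.le]
    calc c * (|ρ| + d) ≤ B.umin / (r + π) * (r + π) := mul_le_mul hc1 h2 (by positivity) (by positivity)
      _ = B.umin := div_mul_cancel₀ _ (by positivity)
      _ ≤ ‖S‖ := h1
  · -- near the Cooper point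
    -- (⊥): ‖S‖ ≥ (2 u_min/π)·d
    have hsin : 2 / π * d ≤ |Real.sin ϑ| := by
      have h1 : 2 / π * d ≤ Real.sin d := Real.mul_le_sin hd0 hfar.le
      have h2 : Real.sin d ≤ |Real.sin (ϑ - π)| := by
        rcases le_total 0 (ϑ - π) with h | h
        · rw [hddef, abs_of_nonneg h]; exact le_abs_self _
        · rw [hddef, abs_of_nonpos h, Real.sin_neg]; exact neg_le_abs _
      rw [Real.sin_sub_pi, abs_neg] at h2
      exact h1.trans h2
    have hP : B.umin * (2 / π) * d ≤ ‖S‖ := by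
      refine le_trans ?_ hperp
      calc B.umin * (2 / π) * d = B.umin * (2 / π * d) := by ring
        _ ≤ u₀ * |Real.sin ϑ| := mul_le_mul hu₀min hsin (by positivity) hu₀pos.le
    -- (∥): ‖S‖ ≥ (10/41)|ρ| − C₁ d
    have hang : |u₀φ - u₀| ≤ klCurveR1 * d := by
      have h := abs_frameRadius_sub_le_angle hA hA20 hd hA₃ hA₄ hm0lo hm0hi (ϑ + θ) (θ + π)
      rwa [perturbedFermiRadius_add_pi (fun k => by simp [TrigPolyC4v.eval_neg]) (μ + 0) θ, show ϑ + θ - (θ + π) = ϑ - π by ring] at h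
    have hcosd : 1 - Real.cos (ϑ - π) ≤ d ^ 2 / 2 := by
      have := Real.one_sub_sq_div_two_le_cos (x := ϑ - π); rw [← sq_abs] at this; linarith
    have hcosϑ : Real.cos ϑ = -Real.cos (ϑ - π) := by rw [Real.cos_sub_pi, neg_neg]
    have hcle : Real.cos (ϑ - π) ≤ 1 := Real.cos_le_one _
    have hd2 : d ^ 2 ≤ π / 2 * d := by rw [sq]; exact mul_le_mul_of_nonneg_right hfar.le hd0
    have hCR : klCurveR1 * d ≤ C₁ * d := by
      refine mul_le_mul_of_nonneg_right ?_ hd0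
      rw [hC₁def]; have : 0 ≤ π ^ 2 * Real.sqrt 2 / 4 := by positivity
      linarith
    have hQ : 10 / 41 * |ρ| - C₁ * d ≤ ‖S‖ := by
      refine le_trans ?_ hpar
      rw [hcosϑ, mul_neg, ← sub_eq_add_neg]
      rcases le_or_gt 0 ρ with hρ0 | hρ0
      · -- ρ ≥ 0: uρ − u₀ c ≥ uρ − u₀ ≥ (uρ − u₀φ) − |u₀φ − u₀| ≥ (10/41)ρ − R1 d
        have hrad : 10 / 41 * (μ + ρ - (μ + 0)) ≤ uρ - u₀φ :=
          frameRadius_level_sub_ge hA hA20 hd (by linarith) (by linarith) hmρhi' (ϑ + θ)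
        rw [abs_of_nonneg hρ0]
        have h1 : u₀ * Real.cos (ϑ - π) ≤ u₀ := by
          have := mul_le_mul_of_nonneg_left hcle hu₀pos.le; linarith
        have h2 : u₀φ - u₀ ≥ -(klCurveR1 * d) := by have := (abs_le.1 hang).1; linarith
        calc 10 / 41 * ρ - C₁ * d ≤ 10 / 41 * ρ - klCurveR1 * d := by linarith
          _ ≤ uρ - u₀ * Real.cos (ϑ - π) := by linarith
          _ ≤ |uρ - u₀ * Real.cos (ϑ - π)| := le_abs_self _
      · -- ρ < 0: u₀ c − uρ = (u₀φ − uρ) − (u₀φ − u₀) − u₀ (1 − c) ≥ (10/41)|ρ| − R1 d − π√2 d²/2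
        have hrad : 10 / 41 * (μ + 0 - (μ + ρ)) ≤ u₀φ - uρ :=
          frameRadius_level_sub_ge hA hA20 hd (by linarith) (by linarith) hm0hi' (ϑ + θ)
        rw [abs_of_neg hρ0]
        have h2 : u₀φ - u₀ ≤ klCurveR1 * d := (abs_le.1 hang).2
        have h3 : u₀ * (1 - Real.cos (ϑ - π)) ≤ π * Real.sqrt 2 * (π / 2 * d) / 2 := by
          have h1c : 0 ≤ 1 - Real.cos (ϑ - π) := by linarith
          calc u₀ * (1 - Real.cos (ϑ - π)) ≤ (π * Real.sqrt 2) * (d ^ 2 / 2) := mul_le_mul hu₀le hcosd h1c (by positivity)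
            _ ≤ π * Real.sqrt 2 * (π / 2 * d) / 2 := by
                have h0 : 0 ≤ π * Real.sqrt 2 := by positivity
                have := mul_le_mul_of_nonneg_left hd2 h0
                linarith
        calc 10 / 41 * -ρ - C₁ * d = 10 / 41 * -ρ - klCurveR1 * d - π * Real.sqrt 2 * (π / 2 * d) / 2 := by rw [hC₁def]; ring
          _ ≤ (u₀φ - uρ) - (u₀φ - u₀) - u₀ * (1 - Real.cos (ϑ - π)) := by linarith
          _ = -(uρ - u₀ * Real.cos (ϑ - π)) := by ring
          _ ≤ |uρ - u₀ * Real.cos (ϑ - π)| := neg_le_abs _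
    -- combine (⊥) and (∥)
    rcases le_or_gt (C₁ * d) (10 / 82 * |ρ|) with hsplit | hsplit
    · have h1 : 10 / 82 * |ρ| ≤ ‖S‖ := by linarith
      have h2 : 10 / 164 * |ρ| + B.umin / π * d ≤ ‖S‖ := by
        have : B.umin / π * d = (B.umin * (2 / π) * d) / 2 := by ring
        rw [this]; linarith
      calc c * (|ρ| + d) = c * |ρ| + c * d := mul_add _ _ _
        _ ≤ 10 / 164 * |ρ| + B.umin / π * d :=
            add_le_add (mul_le_mul_of_nonneg_right hc3 (abs_nonneg _)) (mul_le_mul_of_nonneg_right hc2 hd0)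
        _ ≤ ‖S‖ := h2
    · have h1 : 10 / (82 * C₁) * |ρ| ≤ d := by
        rw [show 10 / (82 * C₁) * |ρ| = (10 / 82 * |ρ|) / C₁ by ring, div_le_iff₀ hC₁]
        linarith
      have h2 : B.umin / π * d + 10 * B.umin / (82 * π * C₁) * |ρ| ≤ ‖S‖ := by
        have h3 : 10 * B.umin / (82 * π * C₁) * |ρ| = B.umin / π * (10 / (82 * C₁) * |ρ|) := by ring
        rw [h3]
        have h4 : B.umin / π * (10 / (82 * C₁) * |ρ|) ≤ B.umin / π * d := mul_le_mul_of_nonneg_left h1 (by positivity)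
        have h5 : B.umin / π * d + B.umin / π * d = B.umin * (2 / π) * d := by ring
        linarith
      calc c * (|ρ| + d) = c * d + c * |ρ| := by ring
        _ ≤ B.umin / π * d + 10 * B.umin / (82 * π * C₁) * |ρ| :=
            add_le_add (mul_le_mul_of_nonneg_right hc2 hd0) (mul_le_mul_of_nonneg_right hc4 (abs_nonneg _))
        _ ≤ ‖S‖ := h2

end Sizes

end Summit.HubbardSuperconductivity.HubbardSuperconductivity.Theorems.C4a

end
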